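import Mathlib
import Literature.NumberTheory.Irrationality.DirichletLValues.LinearIndependence
import HarnessLib

/-!
# The odd Chowla–Milnor space: `dim_ℚ V_k^−(q) ≥ (1/log 2 − o(1)) log q` (Lai–Li 2025)

Topic `Literature/NumberTheory/Irrationality/DirichletLValues`. Typed, cited statement (ONE named fact, no proof; D-0014)
with DEFINITIONS, read on the page (this session, arXiv PDF v2 of 9 Apr 2026) from Li Lai, Jia Li, *A partial result towards
the Chowla–Milnor conjecture*, arXiv:2505.12687 [LaiLi2025]. The Hurwitz zeta values are `hurwitzValue` of
`LinearIndependence.lean` (`ζ(s,x) = Σ_{m≥0} (m+x)^{−s}`).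

HONEST FRAMING (cell zeta5-irr): a record of the literature in the Ball–Rivoal/Zudilin line for Hurwitz zeta values;
nothing here concerns `ζ(5)`. The Chowla–Milnor conjecture itself (Conjecture 1.1: the `φ(q)` values `ζ(k, a/q)`,
`1 ≤ a < q`, `(a,q) = 1`, are linearly independent over `ℚ`) is an OPEN PROBLEM and is not typed here (conjectures are not
Literature).

## What is printed (arXiv v2 page numbers)

* p. 1: "`ζ(s,x) := Σ_{m=0}^{+∞} 1/(m+x)^s`, `Re(s) > 1`" (`0 < x ≤ 1`).
* Definition 1.3 (p. 2): "`ζ⁺(k,a/q) := ζ(k,a/q) + (−1)^k ζ(k,1−a/q)`, `ζ⁻(k,a/q) := ζ(k,a/q) − (−1)^k ζ(k,1−a/q)` …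
  `V_k^−(q) := Span_ℚ {ζ⁻(k,a/q) | 1 ≤ a < q/2, gcd(a,q) = 1}`"; (1.1): `V_k^+(q) ⊂ (2πi)^k ℚ(e^{2πi/q})`,
  `dim_ℚ V_k^+(q) = φ(q)/2`; Conjecture 1.4 (equivalent form of Chowla–Milnor): `dim_ℚ V_k^−(q) = φ(q)/2` and
  `V_k^+(q) ∩ V_k^−(q) = {0}`.
* Theorem 1.2 (Calegari–Dimitrov–Tang): `1, ζ(2,1/3), ζ(2,2/3)` are linearly independent over `ℚ` (tree:
  `Transcendental/CalegariDimitrovTangL2Chi3*.lean`).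
* **Theorem 1.5** (p. 3). "Fix any integer `k ≥ 2`. Then, as the positive integer `q → +∞`, we have
  `dim_ℚ V_k^−(q) ≥ (1/log 2 − o(1)) · log q`." (Proof §8: Nesterenko's criterion in the oscillating form, Theorem 2.1,
  with `r = ⌊log² q⌋`, `α̂ ∼ q log³ q`, `β̂ − krq ∼ (log 2) q log² q`.)

## What is typed

`hurwitzOdd k x = ζ⁻(k,x) = ζ(k,x) − (−1)^k ζ(k,1−x)` (real), `oddChowlaMilnorSpace k q = V_k^−(q)` (a `ℚ`-submodule of `ℝ`),
and the NAMED FACT `laiLi2025_theorem15`: for `k ≥ 2` and every `ε > 0`, for all sufficiently large `q`,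
`(1/log 2 − ε) log q ≤ dim_ℚ V_k^−(q)`.
-/

noncomputable section

open Filter

namespace Literature.NumberTheory.Irrationality.DirichletLValues

/-- The odd part `ζ⁻(k, x) = ζ(k, x) − (−1)^k ζ(k, 1 − x)` of the Hurwitz zeta value (`0 < x < 1`).
[cite: LaiLi2025, Definition 1.3 (p. 2)] -/
def hurwitzOdd (k : ℕ) (x : ℝ) : ℝ := hurwitzValue k x - (-1) ^ k * hurwitzValue k (1 - x)

/-- The odd Chowla–Milnor space `V_k^−(q) = Span_ℚ {ζ⁻(k, a/q) : 1 ≤ a < q/2, gcd(a, q) = 1}` (a `ℚ`-subspace of `ℝ`).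
[cite: LaiLi2025, Definition 1.3 (p. 2)] -/
def oddChowlaMilnorSpace (k q : ℕ) : Submodule ℚ ℝ :=
  Submodule.span ℚ {y : ℝ | ∃ a : ℕ, 1 ≤ a ∧ 2 * a < q ∧ Nat.Coprime a q ∧ y = hurwitzOdd k ((a : ℝ) / q)}

/-- **Lai–Li 2025, Theorem 1.5** (named fact, statement only): "Fix any integer `k ≥ 2`. Then, as the positive integer
`q → +∞`, we have `dim_ℚ V_k^−(q) ≥ (1/log 2 − o(1)) · log q`" — rendered: for every `ε > 0`, eventually in `q`,
`(1/log 2 − ε) log q ≤ dim_ℚ V_k^−(q)` (the number of generators is `φ(q)/2`).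
[cite: LaiLi2025, Theorem 1.5 (p. 3); proof §8 (pp. 35–38)] -/
def laiLi2025_theorem15 : Prop :=
  ∀ k : ℕ, 2 ≤ k → ∀ ε : ℝ, 0 < ε →
    ∀ᶠ q : ℕ in atTop,
      (1 / Real.log 2 - ε) * Real.log q ≤ (Module.finrank ℚ ↥(oddChowlaMilnorSpace k q) : ℝ)

end Literature.NumberTheory.Irrationality.DirichletLValues

end
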